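import Summits.BirchSwinnertonDyer.BirchSwinnertonDyer.Theorems.GenusKolyvaginAtTwoGenusPrimitiveSupplyAtTwoTwistSelmerTransferDownRat
import HarnessLib

/-!
# Route `GenusKolyvaginAtTwo`, crux #2 `GenusPrimitiveSupplyAtTwo` (stmt-BirchSwinnertonDyer-22136):
# STRICT classes are INHERITED by the twist — `#Sel₂(E) ∣ #Sel₂(E^{(d)})` when `Sel₂(E)` is strict at the
# twisting prime (the parity-free, duality-free half of Mazur–Rubin Cor. 3.4 (i) UP), and its `ℚ`-instance for the
# prime Heegner twin

Width seat `bsd-line-gk2-p4` g9 (cell `bsd-f1-sign2`), eleventh file of the twisting-prime series (crux workfile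
`Lines/genus-supply-depth-class.md`). THEOREMS ONLY (no definition, no named fact, no `sorry`); helper
`--supports stmt-BirchSwinnertonDyer-22136`; no item is closed; BSD is not proved by any of this.

WHY. The depth-`2` SUPPLY of the auxiliary-field form of U (g8 habitat capstone
`GenusKolyTwistingPrime.exists_kolyvaginPrime_depthTwo_genusPair_selmer_of_cor34i_of_half`, p623549) produces a depth-`2`
Kolyvagin prime `ℓ` whose even genus twist `Wd^{(−ℓ)}` is `Sel₂`-trivial, from Mazur–Rubin Cor. 3.4 (i) DOWN («`Sel₂(Wd)` NOT
strict at `ℓ` ⟹ `#Sel₂` halves») under ONE point condition on the twin `Wd` (its generator is not halvable over `ℚ(E[4])`).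
The NECESSITY of that condition needs the other side of Cor. 3.4 (i): what happens when `Sel₂(Wd)` IS strict at `ℓ`. The
exact printed answer («`#Sel₂` doubles», UP) needs a parity input beyond Poitou–Tate (Kramer / MR Thm. 2.7, or root numbers);
but the INEQUALITY half is elementary and is all the necessity statement needs: in X11b's currency (transport
`𝓐 = φ_*𝓚_Y`, sandwich `H¹_{𝓚_S} ≤ H¹_𝓐`, `CongruentSelmerTransferTransport`), if EVERY Selmer class of `E` has zero
localisation at `v₀` then `Sel(E) ≤ H¹_{𝓚_{v₀}} ≤ H¹_𝓐 ≅ Sel(Y)`, so `#Sel(E) ∣ #Sel(Y)` — with NO Poitou–Tate, NO local Euler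
characteristic, NO transversality and NO `t_{v₀}` hypothesis. This file proves it and instantiates it:

* §27 `selmerGroup_kummer_le_of_agree_of_forall_localization_eq_zero`,
  `natCard_selmerGroup_dvd_of_agree_of_forall_localization_eq_zero` — congruent pair `Y[p] ≅ E[p]` over any number field,
  any prime `p`: agreement off `v₀` + all Selmer classes of `E` strict at `v₀` ⟹ `#Sel^{(p)}(E) ∣ #Sel^{(p)}(Y)`.
* §28 `natCard_selmerGroup_dvd_twist_of_places_of_forall_localization_eq_zero` — the twist pair `(E, E^{(d)})` at `p = 2`
  with the lead's / gk2-p5's place menu off `v₀` (split ∨ both good `∤ 2` ∨ silent; split ∨ `H¹ = 0` at `∞`), NOTHING assumed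
  at `v₀` except strictness.
* §29 `natCard_selmerGroup_dvd_twin_of_le_strictLocalKer` — `ℚ`-instance in the capstones' currency (gk2-p5
  `natCard_selmerGroup_eq_two_mul_of_not_le_strictLocalKer`, p624297, with the opposite hypothesis): `W/ℚ` globally minimal,
  `Δ_W < 0`, `K` imaginary quadratic with `d_K = −ℓ`, Heegner for `N_W`, `2` split, `Wd` any elliptic model of `W^{(d_K)}`,
  `Sel₂(W) ≤ MazurRubin2010.strictLocalKer W ℚ_ℓ 2` ⟹ `#Sel₂(W) ∣ #Sel₂(Wd)`; hence (`two_dvd_…`, `…_ne_one_…`) a twin with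
  `#Sel₂(W) = 2` strict at `ℓ` has an even genus twist with EVEN `#Sel₂`, never `1`. UNCONDITIONAL (no print fact).

Consumer: `…TwistingPrimeDepthEntangled.lean` (this seat): an ENTANGLED twin (generator halvable over `ℚ(E[4])`) is strict at
EVERY depth-`2` Kolyvagin prime, so the depth-`2` supply fails at every such prime — the point condition of p623549 is necessary.

References: [MazurRubin2010] B. Mazur, K. Rubin, Invent. Math. 181 (2010) = arXiv:0904.3709, Def. 3.1, Lemma 3.2, Prop. 3.3
(first display of the proof: `S_T ⊂ Sel₂(E^F/K) ⊂ S^T`), Cor. 3.4 (i); [MilneADT2006] I §6; [Howard2004HeegnerKolyvagin] Def. 2.1.1.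
-/

set_option linter.dupNamespace false -- tree convention: `Summit.BirchSwinnertonDyer.BirchSwinnertonDyer.Theorems` (summit = sub-problem)
set_option autoImplicit false

noncomputable section

open scoped Classical ContRepresentation

namespace Summit.BirchSwinnertonDyer.BirchSwinnertonDyer.Theorems.GenusKolyTwistLocal

open WeierstrassCurve Field NumberField IsDedekindDomain Function
open Literature.NumberTheory.EllipticCurves Literature.NumberTheory.GaloisRepresentations
open Literature.NumberTheory.GaloisRepresentations.DiscreteGaloisModule (SelmerStructure)
open Literature.NumberTheory.GaloisCohomology
open Summit.BirchSwinnertonDyer.Rank1Residual.X11b.CongruentTransfer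
open Summit.BirchSwinnertonDyer.Rank1Residual.X11b.KummerPT (kummerStrict kummerRelaxed kummerStrict_of_mem
  kummerStrict_of_not_mem)
open Rat.HeightOneSpectrum (primesEquiv natGenerator)

/-! ## §27 Strict Selmer classes are inherited by every structure agreeing off `v₀` (congruent pair, any number field) -/

section Strict

variable {K : Type} [Field K] [NumberField K] (W Y : WeierstrassCurve K) [W.IsElliptic] (p : ℕ) [hp : Fact p.Prime]

omit [W.IsElliptic] hp in
/-- **A Selmer class with zero localisation at every place of `S` lies in the strict Selmer group `H¹_{𝓚_S}`**
(Mazur–Rubin's `Sel_T`: the classes of `Sel₂(E)` vanishing at `T`). [cite: MazurRubin2010, Def. 3.1 (arXiv:0904.3709 p. 9)] -/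
theorem mem_selmerGroup_kummerStrict_of_forall_localization_eq_zero (S : Finset (Place K))
    {c : galoisCohomology (W.torsionGaloisModule (p : ℤ)) 1}
    (hc : c ∈ (W.kummerSelmerStructure (p : ℤ)).selmerGroup)
    (hS : ∀ v ∈ S, galoisCohomology.localization (W.torsionGaloisModule (p : ℤ)) v 1 c = 0) :
    c ∈ (kummerStrict W p S).selmerGroup := by
  rw [SelmerStructure.mem_selmerGroup_iff] at hc ⊢
  intro v
  by_cases hv : v ∈ S
  · rw [kummerStrict_of_mem W p S hv, hS v hv]
    exact zero_mem _
  · rw [kummerStrict_of_not_mem W p S hv]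
    exact hc v

omit [W.IsElliptic] hp in
/-- **STRICT ⟹ `Sel(E) ≤ H¹_𝓐`.** If a Selmer structure `𝓐` on `E[p]` agrees with the Kummer structure off one place `v₀`
and EVERY Selmer class of `E` has zero localisation at `v₀` (`Sel(E)` is strict at `v₀`: `Sel(E) = Sel_{v₀}`), then
`Sel^{(p)}(E) ≤ H¹_𝓐` — the inclusion `Sel_T ⊂ Sel₂(E^F)` of the first display in the proof of Mazur–Rubin's Prop. 3.3, in
the strict case. No duality is used. [cite: MazurRubin2010, Prop. 3.3 (proof, first display) and Def. 3.1 (arXiv:0904.3709 pp. 9–10)] -/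
theorem selmerGroup_kummer_le_of_agree_of_forall_localization_eq_zero
    (𝓐 : SelmerStructure (W.torsionGaloisModule (p : ℤ))) (v₀ : HeightOneSpectrum (𝓞 K))
    (hagree : ∀ v : Place K, v ≠ Sum.inr v₀ → 𝓐 v = W.kummerSelmerStructure (p : ℤ) v)
    (hstrict : ∀ c ∈ (W.kummerSelmerStructure (p : ℤ)).selmerGroup,
      galoisCohomology.localization (W.torsionGaloisModule (p : ℤ)) (Sum.inr v₀) 1 c = 0) :
    (W.kummerSelmerStructure (p : ℤ)).selmerGroup ≤ 𝓐.selmerGroup := by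
  set S : Finset (Place K) := {(Sum.inr v₀ : Place K)} with hSdef
  have hagreeS : ∀ v ∉ S, 𝓐 v = W.kummerSelmerStructure (p : ℤ) v := fun v hv ↦
    hagree v (by simpa [hSdef] using hv)
  intro c hc
  refine (selmerGroup_sandwich_of_agree W p S hagreeS).1 ?_
  refine mem_selmerGroup_kummerStrict_of_forall_localization_eq_zero W p S hc fun v hv ↦ ?_
  have hv' : v = Sum.inr v₀ := by simpa [hSdef] using hv
  subst hv'
  exact hstrict c hc

omit [W.IsElliptic] hp in
/-- **`#Sel^{(p)}(E) ∣ #Sel^{(p)}(Y)` for a congruent pair `Y[p] ≅ E[p]` when `Sel(E)` is strict at the one place where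
the transported conditions may differ** — the duality-free half of Mazur–Rubin Cor. 3.4 (i) in the STRICT case (the exact
printed statement «`d₂` goes UP by `dim H¹_f(K_{v₀}, E[2])`» needs in addition the Poitou–Tate count and a parity input; the
divisibility — i.e. `dim Sel(Y) ≥ dim Sel(E)` — does not). HYPOTHESES: inverse intertwining maps `φ : Y[p] ⇄ E[p] : ψ`, the
transported Kummer structure `𝓐 = φ_*𝓚_Y` (`h𝓐`), one finite place `v₀` off which `𝓐` AGREES with `𝓚_E`, and
`loc_{v₀} c = 0` for every `c ∈ Sel^{(p)}(E)`. Proof: §27 inclusion + `#H¹_𝓐 = #Sel(Y)` (`natCard_selmerGroup_transport_kummer`).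
[cite: MazurRubin2010, Prop. 3.3 and Cor. 3.4 (i) (arXiv:0904.3709 p. 10)] -/
theorem natCard_selmerGroup_dvd_of_agree_of_forall_localization_eq_zero
    (φ : (Y.torsionGaloisModule (p : ℤ)).toContRepresentation →ⁱL
      (W.torsionGaloisModule (p : ℤ)).toContRepresentation)
    (ψ : (W.torsionGaloisModule (p : ℤ)).toContRepresentation →ⁱL
      (Y.torsionGaloisModule (p : ℤ)).toContRepresentation)
    (hψφ : ∀ a, ψ (φ a) = a) (hφψ : ∀ b, φ (ψ b) = b)
    (𝓐 : SelmerStructure (W.torsionGaloisModule (p : ℤ)))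
    (h𝓐 : ∀ v, 𝓐 v = (Y.kummerSelmerStructure (p : ℤ) v).map
      (galoisCohomology.map (φ.restrictField (Place.Completion v)) 1))
    (v₀ : HeightOneSpectrum (𝓞 K))
    (hagree : ∀ v : Place K, v ≠ Sum.inr v₀ → 𝓐 v = W.kummerSelmerStructure (p : ℤ) v)
    (hstrict : ∀ c ∈ (W.kummerSelmerStructure (p : ℤ)).selmerGroup,
      galoisCohomology.localization (W.torsionGaloisModule (p : ℤ)) (Sum.inr v₀) 1 c = 0) :
    Nat.card (W.selmerGroup (p : ℤ)) ∣ Nat.card (Y.selmerGroup (p : ℤ)) := by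
  rw [← natCard_selmerGroup_transport_kummer W Y p φ ψ hψφ hφψ 𝓐 h𝓐,
    selmerGroup_eq_selmerGroup_kummerSelmerStructure]
  exact AddSubgroup.card_dvd_of_le
    (selmerGroup_kummer_le_of_agree_of_forall_localization_eq_zero W p 𝓐 v₀ hagree hstrict)

end Strict

/-! ## §28 The twist pair `(E, E^{(d)})` at `p = 2`: strict at `v₀` ⟹ `#Sel₂(E) ∣ #Sel₂(E^{(d)})`, from the place menu -/

section Twist

variable {K : Type} [Field K] [NumberField K] (W : WeierstrassCurve K) [W.IsElliptic]

/-- **Mazur–Rubin Cor. 3.4 (i), STRICT case, divisibility half, for the quadratic-twist pair `(E, E^{(d)})` at `p = 2`.**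
For `W` elliptic over a number field `K`, `d ≠ 0`, ANY elliptic model `Wd` of `W^{(d)}` and one finite place `v₀`: IF every
finite `v ≠ v₀` is split (`d ∈ (K_v^×)²`) or good for both curves with `v ∤ 2` or silent (`v ∤ 2`, no `K_v`-rational
`2`-torsion on either curve), every infinite place is split or has `H¹(K_w, ·) = 0` for both curves (the place menu of the
lead's `GenusKolyTwistRamified.natCard_selmerGroup_twist_mul_two_eq_of_places`, verbatim), and EVERY class of `Sel₂(W)` has zero
localisation at `v₀`, THEN `#Sel₂(W) ∣ #Sel₂(Wd)`. Nothing is assumed AT `v₀` (no ramification, no `#W(K_{v₀})[2]`, no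
transversality) and no print fact is used: the intertwining pair and the split-place agreement are gk2-p5's
`exists_intertwining_hsplit` (Lemma 2.10 (i)), the other rows Lemma 2.10 (ii), (iv), (v) as kernel theorems of this series.
[cite: MazurRubin2010, Lemma 2.10, Prop. 3.3, Cor. 3.4 (i) (arXiv:0904.3709 pp. 8–10)] -/
theorem natCard_selmerGroup_dvd_twist_of_places_of_forall_localization_eq_zero
    {d : K} (hd : d ≠ 0) {Wd : WeierstrassCurve K} [Wd.IsElliptic] {C : VariableChange K}
    (hWd : C • W.quadraticTwist d = Wd) (v₀ : HeightOneSpectrum (𝓞 K))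
    (hfin : ∀ v : HeightOneSpectrum (𝓞 K), v ≠ v₀ →
      (∃ s : v.adicCompletion K, s ^ 2 = algebraMap K (v.adicCompletion K) d) ∨
      (((2 : ℕ) : 𝓞 K) ∉ v.asIdeal ∧ W.HasGoodReductionAt v ∧ Wd.HasGoodReductionAt v) ∨
      (((2 : ℕ) : 𝓞 K) ∉ v.asIdeal ∧
        Nat.card (nsmulAddMonoidHom 2 : (W.baseChange (v.adicCompletion K)).toAffine.Point →+ _).ker = 1 ∧
        Nat.card (nsmulAddMonoidHom 2 : (Wd.baseChange (v.adicCompletion K)).toAffine.Point →+ _).ker = 1))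
    (hinf : ∀ w : InfinitePlace K,
      (∃ s : w.Completion, s ^ 2 = algebraMap K w.Completion d) ∨
      ((∀ x : galoisCohomology (W.localGaloisModule w.Completion) 1, x = 0) ∧
        (∀ x : galoisCohomology (Wd.localGaloisModule w.Completion) 1, x = 0)))
    (hstrict : ∀ c ∈ (W.kummerSelmerStructure ((2 : ℕ) : ℤ)).selmerGroup,
      galoisCohomology.localization (W.torsionGaloisModule ((2 : ℕ) : ℤ)) (Sum.inr v₀) 1 c = 0) :
    Nat.card (W.selmerGroup ((2 : ℕ) : ℤ)) ∣ Nat.card (Wd.selmerGroup ((2 : ℕ) : ℤ)) := by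
  haveI : NeZero (2 : K) := ⟨two_ne_zero⟩
  haveI : Fact (Nat.Prime 2) := ⟨Nat.prime_two⟩
  obtain ⟨φ, ψ, hψφ, hφψ, hsplit⟩ := exists_intertwining_hsplit W hd hWd
  -- the transported Kummer structure of `Wd`
  let 𝓐 : SelmerStructure (W.torsionGaloisModule ((2 : ℕ) : ℤ)) := fun v ↦
    (Wd.kummerSelmerStructure ((2 : ℕ) : ℤ) v).map
      (galoisCohomology.map (φ.restrictField (Place.Completion v)) 1)
  have h𝓐 : ∀ v, 𝓐 v = (Wd.kummerSelmerStructure ((2 : ℕ) : ℤ) v).map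
      (galoisCohomology.map (φ.restrictField (Place.Completion v)) 1) := fun _ ↦ rfl
  refine natCard_selmerGroup_dvd_of_agree_of_forall_localization_eq_zero W Wd 2 φ ψ hψφ hφψ 𝓐 h𝓐 v₀ ?_ hstrict
  -- agreement at every place other than `v₀` (verbatim from `natCard_selmerGroup_twist_mul_two_eq_of_local`)
  rintro (w | v) hv
  · rcases hinf w with ⟨s, hs⟩ | ⟨hW, hWd'⟩
    · rw [h𝓐, kummerSelmerStructure_apply, kummerSelmerStructure_apply]
      exact hsplit (Place.Completion (Sum.inl w)) ⟨s, hs⟩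
    · rw [h𝓐, kummerSelmerStructure_apply, kummerSelmerStructure_apply]
      exact map_kummerLocalConditionAt_eq_of_eq_top W Wd ((2 : ℕ) : ℤ) (Place.Completion (Sum.inl w)) φ ψ hφψ
        (kummerLocalConditionAt_eq_top_of_forall_eq_zero Wd _ _ hWd')
        (kummerLocalConditionAt_eq_top_of_forall_eq_zero W _ _ hW)
  · have hvv₀ : v ≠ v₀ := fun h ↦ hv (by rw [h])
    rcases hfin v hvv₀ with ⟨s, hs⟩ | ⟨h2v, hvW, hvWd⟩ | ⟨h2v, h1W, h1Wd⟩
    · rw [h𝓐, kummerSelmerStructure_apply, kummerSelmerStructure_apply]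
      exact hsplit (Place.Completion (Sum.inr v)) ⟨s, hs⟩
    · exact transport_kummer_inr_eq_of_good W Wd 2 φ ψ hφψ 𝓐 h𝓐 h2v hvW hvWd
    · rw [h𝓐, kummerSelmerStructure_apply, kummerSelmerStructure_apply]
      exact map_kummerLocalConditionAt_adicCompletion_eq_of_natCard_ker_eq_one W Wd v two_ne_zero h2v h1W h1Wd φ

end Twist

/-! ## §29 The `ℚ`-instance for the prime Heegner twin, in the capstones' currency -/

section Rat

variable (W : WeierstrassCurve ℚ)

/-- **`Sel₂(W) ≤ strictLocalKer W ℚ_p 2` makes every `2`-Selmer class vanish under the genuine localisation at the place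
`v` over `p`** (the converse bookkeeping of gk2-p5's `exists_selmer_localization_ne_zero_of_not_le_strictLocalKer`:
`MazurRubin2010.strictLocalKer = torsionLocalKer` is invariant under `ℚ_v ≃ ℚ_p` and is the kernel of `loc_v`).
[cite: MazurRubin2010, Def. 3.1] [cite: McCallumLMS1991, §3 (3)] -/
theorem forall_selmer_localization_eq_zero_of_le_strictLocalKer [W.IsElliptic] (v : HeightOneSpectrum (𝓞 ℚ))
    (h : haveI := Fact.mk (primesEquiv v).2
      W.selmerGroup 2 ≤ MazurRubin2010.strictLocalKer W ℚ_[((primesEquiv v : Nat.Primes) : ℕ)] 2) :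
    ∀ c ∈ (W.kummerSelmerStructure ((2 : ℕ) : ℤ)).selmerGroup,
      galoisCohomology.localization (W.torsionGaloisModule ((2 : ℕ) : ℤ)) (Sum.inr v) 1 c = 0 := by
  haveI := Fact.mk (primesEquiv v).2
  letI : Algebra ℚ (v.adicCompletion ℚ) := inferInstance
  haveI : CharZero (v.adicCompletion ℚ) :=
    Literature.NumberTheory.GaloisRepresentations.charZero_adicCompletion v
  -- `strictLocalKer = torsionLocalKer` (definitional), at level `((2 : ℕ) : ℤ)`
  have h' : W.selmerGroup ((2 : ℕ) : ℤ) ≤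
      W.torsionLocalKer ℚ_[((primesEquiv v : Nat.Primes) : ℕ)] ((2 : ℕ) : ℤ) := h
  intro c hc
  have hcS : c ∈ W.selmerGroup ((2 : ℕ) : ℤ) := by
    rw [selmerGroup_eq_selmerGroup_kummerSelmerStructure]
    exact hc
  have h1 : c ∈ W.torsionLocalKer (v.adicCompletion ℚ) ((2 : ℕ) : ℤ) :=
    (GenusKolyTwistingPrime.mem_torsionLocalKer_padic_iff W
      (RingEquivClass.toRingEquiv (Rat.HeightOneSpectrum.adicCompletion.padicEquiv (R := 𝓞 ℚ) v))
      ((2 : ℕ) : ℤ) c).mp (h' hcS)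
  exact (mem_torsionLocalKer_iff_localization_eq_zero_rat W v c).mp h1

/-- **MAZUR–RUBIN COR. 3.4 (i), STRICT CASE, DIVISIBILITY HALF, FOR THE PRIME HEEGNER TWIN — UNCONDITIONAL.** Let `W/ℚ` be
globally minimal elliptic with `Δ_W < 0`, `K` imaginary quadratic with `d_K = −ℓ` (`ℓ` prime), Heegner for `N_W`, `2` split in
`K`, `Wd` an elliptic model of `W^{(d_K)}`. IF `Sel₂(W)` IS strict at `ℓ` (`Sel₂(W) ≤ MazurRubin2010.strictLocalKer W ℚ_ℓ 2`:
every `2`-Selmer class has `loc_ℓ = 0`), THEN `#Sel₂(W) ∣ #Sel₂(Wd)` — the twist INHERITS the whole `2`-Selmer group of `W`.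
Companion of gk2-p5's `natCard_selmerGroup_eq_two_mul_of_not_le_strictLocalKer` (the NON-strict case, `#Sel₂(W) = 2#Sel₂(Wd)`,
modulo {PT, Tate χ}); this strict half uses NO print fact. (The printed UP statement `#Sel₂(Wd) = 2#Sel₂(W)` would need a
parity input in addition.) [cite: MazurRubin2010, Prop. 3.3, Cor. 3.4 (i), Lemma 2.10 (arXiv:0904.3709 pp. 8–10)]
[cite: GrossLMS1991, §1 (p. 235)] -/
theorem natCard_selmerGroup_dvd_twin_of_le_strictLocalKer [W.IsElliptic] [W.IsGloballyMinimal]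
    {K : Type} [Field K] [NumberField K]
    (hΔ : W.Δ < 0) (hK : IsImaginaryQuadratic K)
    (hH : SatisfiesHeegnerHypothesis (W.conductorNorm ℤ) K) (h2K : ((Ideal.span {(2 : ℤ)}).primesOver (𝓞 K)).ncard = 2)
    {ℓ : ℕ} [Fact ℓ.Prime] (hd : discr K = -(ℓ : ℤ)) (Wd : WeierstrassCurve ℚ) [Wd.IsElliptic]
    (hWd : ∃ C : VariableChange ℚ, C • W.quadraticTwist (discr K : ℚ) = Wd)
    (hs : W.selmerGroup 2 ≤ MazurRubin2010.strictLocalKer W ℚ_[ℓ] 2) :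
    Nat.card (W.selmerGroup 2) ∣ Nat.card (Wd.selmerGroup 2) := by
  have hℓ : ℓ.Prime := Fact.out
  -- the place `v₀` of `ℚ` over `ℓ`
  obtain ⟨v₀, hv₀⟩ : ∃ v : HeightOneSpectrum (𝓞 ℚ), ((primesEquiv v : Nat.Primes) : ℕ) = ℓ :=
    ⟨primesEquiv.symm ⟨ℓ, hℓ⟩, by rw [Equiv.apply_symm_apply]⟩
  have hℓv₀ : (ℓ : 𝓞 ℚ) ∈ v₀.asIdeal := by
    rw [← hv₀]
    exact Rat.HeightOneSpectrum.natCast_natGenerator_mem v₀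
  obtain ⟨C, hC⟩ := hWd
  have hd0 : (discr K : ℚ) ≠ 0 := by
    rw [hd]
    push_cast
    exact neg_ne_zero.mpr (by exact_mod_cast hℓ.ne_zero)
  -- strictness in the localisation currency
  have hstrict : ∀ c ∈ (W.kummerSelmerStructure ((2 : ℕ) : ℤ)).selmerGroup,
      galoisCohomology.localization (W.torsionGaloisModule ((2 : ℕ) : ℤ)) (Sum.inr v₀) 1 c = 0 := by
    apply forall_selmer_localization_eq_zero_of_le_strictLocalKer W v₀
    subst hv₀
    exact hs
  have h := natCard_selmerGroup_dvd_twist_of_places_of_forall_localization_eq_zero W hd0 hC v₀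
    (twist_place_menu_finite_rat W hK.1 hH h2K hℓ hd hℓv₀ hC) (twist_place_menu_infinite_rat W hΔ hd0 hC) hstrict
  exact h

/-- **A STRICT ROW-1 TWIN HAS AN EVEN GENUS TWIST WITH EVEN `#Sel₂`.** In the frame of §29 with `#Sel₂(W) = 2` (the LEVEL
LAW's twin `A = E^{(d_K)}`, here in the role of `W`, and `K = ℚ(√−ℓ)` its prime Heegner auxiliary field): if `Sel₂(W)` is strict
at `ℓ` then `2 ∣ #Sel₂(Wd)` for every elliptic model `Wd` of `W^{(−ℓ)}`; in particular `#Sel₂(Wd) ≠ 1` — the conclusion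
«every model of the even genus twist has `#Sel₂ = 1`» of the depth-`2` supply FAILS at such an `ℓ`. Unconditional.
[cite: MazurRubin2010, Cor. 3.4 (i) (arXiv:0904.3709 p. 10)] -/
theorem two_dvd_natCard_selmerGroup_twin_of_le_strictLocalKer [W.IsElliptic] [W.IsGloballyMinimal]
    {K : Type} [Field K] [NumberField K]
    (hΔ : W.Δ < 0) (hK : IsImaginaryQuadratic K)
    (hH : SatisfiesHeegnerHypothesis (W.conductorNorm ℤ) K) (h2K : ((Ideal.span {(2 : ℤ)}).primesOver (𝓞 K)).ncard = 2)
    {ℓ : ℕ} [Fact ℓ.Prime] (hd : discr K = -(ℓ : ℤ)) (h2 : Nat.card (W.selmerGroup 2) = 2)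
    (Wd : WeierstrassCurve ℚ) [Wd.IsElliptic] (hWd : ∃ C : VariableChange ℚ, C • W.quadraticTwist (discr K : ℚ) = Wd)
    (hs : W.selmerGroup 2 ≤ MazurRubin2010.strictLocalKer W ℚ_[ℓ] 2) :
    2 ∣ Nat.card (Wd.selmerGroup 2) ∧ Nat.card (Wd.selmerGroup 2) ≠ 1 := by
  have h := natCard_selmerGroup_dvd_twin_of_le_strictLocalKer W hΔ hK hH h2K hd Wd hWd hs
  rw [h2] at h
  refine ⟨h, fun h1 ↦ ?_⟩
  rw [h1] at h
  exact absurd (Nat.le_of_dvd one_pos h) (by norm_num)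

end Rat

end Summit.BirchSwinnertonDyer.BirchSwinnertonDyer.Theorems.GenusKolyTwistLocal

end
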